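import Mathlib
import Summits.MatrixMultiplication.MatrixMultiplication.Theses.MatrixPointInterpolation
import Summits.MatrixMultiplication.MatrixMultiplication.Theorems.MatrixPointInterpolationWindowedKaplanskyCapelli

/-!
# Crux `TightWindows` (stmt-MatrixMultiplication-18939), line `shirshov-split` — `k = 3` core,
# SLACK locus (stub `stub_coreThreeSlack`) + shared lemmas of the rank-one locus

Window-free Branch-II core at point size `3` (pencil identities (P1) `[[Z₁,Y][Z₂,Y],Y] = 0`,
(P2) `[[Z₁,Y]·Y·[Z₂,Y],Y] = 0` for every `Y ∈ V_L`, slots `Z₁ ∈ V_{e₁}`, `Z₂ ∈ V_{e₂}`,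
`e₁ + e₂ ≤ d − 6L`).  This file proves the SLACK locus verbatim: if generation is already complete
at a level `e` with `e + 1 + 6L ≤ d`, the slot `Z₁` is full and tensor separation
(`Masquerade.eq_zero_of_sum_mul_mul_eq_zero`) closes — the "budget wall" is the whole difficulty of
the general case.  It also carries the shared lemmas of the rank-one locus (file
`…StubCoreThreeRankOnePencil.lean`): the eight-term expansion `key8`, the sandwich rule, the
irreducibility of a generating pair `invariant_eq_top`, the word count for a rank-one letter
`two_mul_sq_le_of_rankOne` (`2n² ≤ (d+1)(d+2)`), and the invariance of the word filtration under a
change of letters spanning the same pencil (`wordSpan_comp_swap`, `wordSpan_eq_of_gen_mem`).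
Stub-worker of the line's wave 6, 2026-08-17 (research notes on the general case: crux `NOTES.md`).
-/

set_option linter.dupNamespace false
-- `MatrixMultiplication.MatrixMultiplication` is the summit/sub-problem path (D-0017)

namespace Summit.MatrixMultiplication.MatrixMultiplication.Theorems.TightWindows

open scoped BigOperators
open Matrix Summit.MatrixMultiplication.MatrixMultiplication.Theorems.Masquerade

/-! ### Ring-theoretic bookkeeping -/

/-- The eight-term expansion of `[[b,a]·[wb,a], a]` keeping the sandwiches `b·X·b` visible.
[folklore] -/
theorem key8 {R : Type*} [Ring R] (a b w : R) :
    (b * a - a * b) * (w * b * a - a * (w * b)) * a - a * ((b * a - a * b) * (w * b * a - a * (w * b))) =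
      b * (a * w) * b * (a * a) - b * (a * (a * w)) * b * a - a * (b * w * b) * (a * a) +
        a * a * (b * w * b) * a + a * (b * (a * (a * w)) * b) - a * a * (b * (a * w) * b) := by
  noncomm_ring

/-- Sandwich rule for a rank-one matrix: `(u vᵀ) X (u vᵀ) = (vᵀ X u) · u vᵀ`. [folklore] -/
theorem sandwich {n : ℕ} (u v : Fin n → ℂ) (X : Matrix (Fin n) (Fin n) ℂ) :
    vecMulVec u v * X * vecMulVec u v = (v ⬝ᵥ X *ᵥ u) • vecMulVec u v := by
  rw [Matrix.mul_assoc, Matrix.mul_vecMulVec, Matrix.vecMulVec_mul_vecMulVec, Matrix.vecMulVec_smul]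

/-- `(u vᵀ) y = (vᵀ y) u`. [folklore] -/
theorem vecMulVec_mulVec_eq_smul {n : ℕ} (u v y : Fin n → ℂ) :
    vecMulVec u v *ᵥ y = (v ⬝ᵥ y) • u := by
  rw [vecMulVec_mulVec, op_smul_eq_smul]

/-- `2 · ∑_{p < j} (j - p) = j (j + 1)`. [folklore] -/
theorem two_mul_sum_range_sub (j : ℕ) : 2 * ∑ p ∈ Finset.range j, (j - p) = j * (j + 1) := by
  induction j with
  | zero => simp
  | succ j ih =>
    rw [Finset.sum_range_succ, Finset.sum_congr rfl (g := fun p => (j - p) + 1)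
      (fun p hp => by rw [Finset.mem_range] at hp; omega), Finset.sum_add_distrib,
      Finset.sum_const, Finset.card_range]
    have h1 : j + 1 - j = 1 := by omega
    rw [h1, smul_eq_mul, mul_one]
    linarith [ih]

/-! ### Irreducibility of a generating pair -/

/-- **A generating pair is irreducible.**  If the words in `A` span `M_n`, a subspace of `ℂⁿ`
stable under both generators and containing a non-zero vector is all of `ℂⁿ`. [folklore] -/
theorem invariant_eq_top {n d : ℕ} {A : Fin 2 → Matrix (Fin n) (Fin n) ℂ}
    (hspan : Submodule.span ℂ {M : Matrix (Fin n) (Fin n) ℂ |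
      ∃ w : List (Fin 2), w.length ≤ d ∧ (w.map A).prod = M} = ⊤)
    (S : Submodule ℂ (Fin n → ℂ)) (hS : ∀ x : Fin 2, ∀ y ∈ S, A x *ᵥ y ∈ S)
    {y : Fin n → ℂ} (hy : y ∈ S) (hy0 : y ≠ 0) : S = ⊤ := by
  -- every matrix preserves `S`
  have hinv : ∀ (X : Matrix (Fin n) (Fin n) ℂ), ∀ z ∈ S, X *ᵥ z ∈ S := by
    intro X
    have hX : X ∈ Submodule.span ℂ {M : Matrix (Fin n) (Fin n) ℂ |
        ∃ w : List (Fin 2), w.length ≤ d ∧ (w.map A).prod = M} := by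
      rw [hspan]; exact Submodule.mem_top
    induction hX using Submodule.span_induction with
    | mem X hX =>
      obtain ⟨w, -, rfl⟩ := hX
      induction w with
      | nil => intro z hz; simpa using hz
      | cons x w ih =>
        intro z hz
        simp only [List.map_cons, List.prod_cons, ← Matrix.mulVec_mulVec]
        exact hS x _ (ih z hz)
    | zero => intro z _; simp
    | add X Y _ _ hX hY =>
      intro z hz
      rw [Matrix.add_mulVec]
      exact S.add_mem (hX z hz) (hY z hz)
    | smul r X _ hX =>
      intro z hz
      rw [Matrix.smul_mulVec]
      exact S.smul_mem r (hX z hz)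
  obtain ⟨j, hj⟩ : ∃ j, y j ≠ 0 := by
    by_contra h
    push Not at h
    exact hy0 (funext h)
  rw [eq_top_iff]
  intro w _
  have key := hinv (Matrix.vecMulVec w (Pi.single j 1)) y hy
  have e : Matrix.vecMulVec w (Pi.single j (1 : ℂ)) *ᵥ y = y j • w := by
    rw [vecMulVec_mulVec_eq_smul, single_one_dotProduct]
  rw [e] at key
  have := S.smul_mem (y j)⁻¹ key
  rwa [smul_smul, inv_mul_cancel₀ hj, one_smul] at this

/-! ### Generation by a matrix and a rank-one matrix is slow -/

/-- **Word count for a rank-one generator.**  If `A 1 = u vᵀ`, every word in `A 0, A 1` is a power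
of `a = A 0` or a multiple of `(a^p u)(vᵀ a^q)` with `p + q + 1` at most its length; so generation of
`M_n` in length `d` forces `2 n² ≤ (d + 1)(d + 2)`. [folklore] -/
theorem two_mul_sq_le_of_rankOne {n d : ℕ} {A : Fin 2 → Matrix (Fin n) (Fin n) ℂ}
    {a : Matrix (Fin n) (Fin n) ℂ} {u v : Fin n → ℂ} (ha : A 0 = a) (hb : A 1 = vecMulVec u v)
    (hspan : Submodule.span ℂ {M : Matrix (Fin n) (Fin n) ℂ |
      ∃ w : List (Fin 2), w.length ≤ d ∧ (w.map A).prod = M} = ⊤) :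
    2 * n ^ 2 ≤ (d + 1) * (d + 2) := by
  classical
  -- the graded family of spans
  let Sset : ℕ → Set (Matrix (Fin n) (Fin n) ℂ) := fun j =>
    (fun i : ℕ => a ^ i) '' {i | i ≤ j} ∪
      (fun pq : ℕ × ℕ => vecMulVec (a ^ pq.1 *ᵥ u) (v ᵥ* a ^ pq.2)) '' {pq | pq.1 + pq.2 + 1 ≤ j}
  let T : ℕ → Submodule ℂ (Matrix (Fin n) (Fin n) ℂ) := fun j => Submodule.span ℂ (Sset j)
  have hmono : ∀ {j j' : ℕ}, j ≤ j' → T j ≤ T j' := fun h => Submodule.span_mono (by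
    rintro M (⟨i, hi, rfl⟩ | ⟨pq, hpq, rfl⟩)
    · exact Or.inl ⟨i, le_trans (show i ≤ _ from hi) h, rfl⟩
    · exact Or.inr ⟨pq, le_trans (show pq.1 + pq.2 + 1 ≤ _ from hpq) h, rfl⟩)
  have hpow : ∀ {i j : ℕ}, i ≤ j → a ^ i ∈ T j :=
    fun {i j} h => Submodule.subset_span (Or.inl ⟨i, h, rfl⟩)
  have hrk : ∀ {p q j : ℕ}, p + q + 1 ≤ j → vecMulVec (a ^ p *ᵥ u) (v ᵥ* a ^ q) ∈ T j :=
    fun {p q j} h => Submodule.subset_span (Or.inr ⟨(p, q), h, rfl⟩)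
  have hu0 : ∀ w : Fin n → ℂ, vecMulVec u w = vecMulVec (a ^ 0 *ᵥ u) w := fun w => by
    rw [pow_zero, Matrix.one_mulVec]
  -- closure under left multiplication by the generators
  have hgen : ∀ (x : Fin 2) (j : ℕ), ∀ M ∈ Sset j, A x * M ∈ T (j + 1) := by
    refine Fin.forall_fin_two.2 ⟨fun j M hM => ?_, fun j M hM => ?_⟩
    · rw [ha]
      rcases hM with ⟨i, hi, rfl⟩ | ⟨pq, hpq, rfl⟩
      · have hi' : i ≤ j := hi
        show a * a ^ i ∈ T (j + 1)
        rw [← pow_succ']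
        exact hpow (by omega)
      · have hpq' : pq.1 + pq.2 + 1 ≤ j := hpq
        show a * vecMulVec (a ^ pq.1 *ᵥ u) (v ᵥ* a ^ pq.2) ∈ T (j + 1)
        rw [Matrix.mul_vecMulVec, Matrix.mulVec_mulVec, ← pow_succ']
        exact hrk (by omega)
    · rw [hb]
      rcases hM with ⟨i, hi, rfl⟩ | ⟨pq, hpq, rfl⟩
      · have hi' : i ≤ j := hi
        show vecMulVec u v * a ^ i ∈ T (j + 1)
        rw [Matrix.vecMulVec_mul, hu0]
        exact hrk (by omega)
      · have hpq' : pq.1 + pq.2 + 1 ≤ j := hpq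
        show vecMulVec u v * vecMulVec (a ^ pq.1 *ᵥ u) (v ᵥ* a ^ pq.2) ∈ T (j + 1)
        rw [Matrix.vecMulVec_mul_vecMulVec, Matrix.vecMulVec_smul, hu0]
        exact Submodule.smul_mem _ _ (hrk (by omega))
  have hgen' : ∀ (x : Fin 2) (j : ℕ), ∀ M ∈ T j, A x * M ∈ T (j + 1) := by
    intro x j M hM
    induction hM using Submodule.span_induction with
    | mem M hM => exact hgen x j M hM
    | zero => simp
    | add M N _ _ hM hN => rw [Matrix.mul_add]; exact Submodule.add_mem _ hM hN
    | smul r M _ hM => rw [Matrix.mul_smul]; exact Submodule.smul_mem _ r hM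
  have hword : ∀ w : List (Fin 2), (w.map A).prod ∈ T w.length := by
    intro w
    induction w with
    | nil => simpa using hpow (le_refl 0)
    | cons x w ih =>
      rw [List.map_cons, List.prod_cons, List.length_cons]
      exact hgen' x _ _ ih
  have hle : (⊤ : Submodule ℂ (Matrix (Fin n) (Fin n) ℂ)) ≤ T d := by
    rw [← hspan, Submodule.span_le]
    rintro M ⟨w, hw, rfl⟩
    exact hmono hw (hword w)
  -- counting the family in degree `d`
  let F : Finset (Matrix (Fin n) (Fin n) ℂ) :=
    (Finset.range (d + 1)).image (fun i => a ^ i) ∪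
      ((Finset.range d).sigma fun p => Finset.range (d - p)).image
        (fun pq : (Σ _ : ℕ, ℕ) => vecMulVec (a ^ pq.1 *ᵥ u) (v ᵥ* a ^ pq.2))
  have hsub : Sset d ⊆ (F : Set (Matrix (Fin n) (Fin n) ℂ)) := by
    rintro M (⟨i, hi, rfl⟩ | ⟨pq, hpq, rfl⟩)
    · have hi' : i ≤ d := hi
      refine Finset.mem_coe.2 (Finset.mem_union_left _ (Finset.mem_image.2 ?_))
      exact ⟨i, Finset.mem_range.2 (by omega), rfl⟩
    · have hpq' : pq.1 + pq.2 + 1 ≤ d := hpq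
      refine Finset.mem_coe.2 (Finset.mem_union_right _ (Finset.mem_image.2 ?_))
      refine ⟨⟨pq.1, pq.2⟩, Finset.mem_sigma.2 ⟨Finset.mem_range.2 ?_, Finset.mem_range.2 ?_⟩, rfl⟩
      · show pq.1 < d
        omega
      · show pq.2 < d - pq.1
        omega
  have hcard : F.card ≤ (d + 1) + ∑ p ∈ Finset.range d, (d - p) := by
    refine (Finset.card_union_le _ _).trans (add_le_add ?_ ?_)
    · exact Finset.card_image_le.trans (by simp)
    · exact Finset.card_image_le.trans (by rw [Finset.card_sigma]; simp)
  have hfin : Module.finrank ℂ (T d) ≤ F.card := by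
    have h1 := finrank_span_finset_le_card (R := ℂ) F
    rw [Set.finrank] at h1
    exact (Submodule.finrank_mono (Submodule.span_mono hsub)).trans h1
  have hn2 : n ^ 2 ≤ F.card := by
    have h := Submodule.finrank_mono hle
    rw [finrank_top, Module.finrank_matrix, Fintype.card_fin, Module.finrank_self,
      mul_one] at h
    rw [sq]
    exact h.trans hfin
  have htri := two_mul_sum_range_sub d
  nlinarith [hcard, hn2, htri]

/-! ### Either generator of rank one (relabelling the letters) -/

/-- Relabelling the two letters does not change the word filtration. [folklore] -/
theorem wordSpan_comp_swap {n : ℕ} (A : Fin 2 → Matrix (Fin n) (Fin n) ℂ) (j : ℕ) :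
    wordSpan (A ∘ Equiv.swap (0 : Fin 2) 1) j = wordSpan A j := by
  have key : ∀ (B : Fin 2 → Matrix (Fin n) (Fin n) ℂ),
      {M : Matrix (Fin n) (Fin n) ℂ | ∃ w : List (Fin 2), w.length ≤ j ∧
        (w.map (B ∘ Equiv.swap (0 : Fin 2) 1)).prod = M} ⊆
      {M : Matrix (Fin n) (Fin n) ℂ | ∃ w : List (Fin 2), w.length ≤ j ∧ (w.map B).prod = M} := by
    rintro B M ⟨w, hw, rfl⟩
    exact ⟨w.map (Equiv.swap (0 : Fin 2) 1), by simpa using hw, by rw [List.map_map]⟩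
  refine le_antisymm (Submodule.span_mono (key A)) (Submodule.span_mono ?_)
  have h := key (A ∘ Equiv.swap (0 : Fin 2) 1)
  have e : (A ∘ Equiv.swap (0 : Fin 2) 1) ∘ Equiv.swap (0 : Fin 2) 1 = A := by
    funext x
    simp [Function.comp, Equiv.swap_apply_self]
  rwa [e] at h

/-! ### A rank-one matrix anywhere in the pencil `span{1, A 0, A 1}` -/

/-- If the new letters are affine combinations of the old ones (elements of `V_1`), the new word
filtration is below the old one. [folklore] -/
theorem wordSpan_le_of_gen_mem {n : ℕ} {A A' : Fin 2 → Matrix (Fin n) (Fin n) ℂ}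
    (h : ∀ x : Fin 2, A' x ∈ wordSpan A 1) (j : ℕ) : wordSpan A' j ≤ wordSpan A j := by
  have hword : ∀ w : List (Fin 2), (w.map A').prod ∈ wordSpan A w.length := by
    intro w
    induction w with
    | nil => simpa using one_mem_wordSpan A 0
    | cons x w ih =>
      rw [List.map_cons, List.prod_cons, List.length_cons, Nat.add_comm]
      exact mul_mem_wordSpan (h x) ih
  refine Submodule.span_le.2 ?_
  rintro M ⟨w, hw, rfl⟩
  exact wordSpan_mono A hw (hword w)

/-- Two pairs of letters spanning the same affine pencil have the same word filtration.
[folklore] -/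
theorem wordSpan_eq_of_gen_mem {n : ℕ} {A A' : Fin 2 → Matrix (Fin n) (Fin n) ℂ}
    (h : ∀ x : Fin 2, A' x ∈ wordSpan A 1) (h' : ∀ x : Fin 2, A x ∈ wordSpan A' 1) (j : ℕ) :
    wordSpan A' j = wordSpan A j :=
  le_antisymm (wordSpan_le_of_gen_mem h j) (wordSpan_le_of_gen_mem h' j)

/-! ### The slack case of the open core: a full slot one step below the budget -/

/-- **`stub_coreThree` with slack.**  The registered statement of `stub_coreThree`, verbatim,
under the single extra hypothesis that generation is already complete `6L + 1` steps before `d`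
(`V_e = M_n` for some `e` with `e + 1 + 6L ≤ d`).  Then identity (P1) at the non-`3`-algebraic
`Y₀` has a FULL first slot `X ∈ M_n` against the second slot `A x ∈ V_1`; it reads
`∑_{i<3} Y₀^i · X · Q_i = 0` with `Q_2 = [A x, Y₀]`, so tensor separation
(`Masquerade.eq_zero_of_sum_mul_mul_eq_zero`, powers `1, Y₀, Y₀²` independent) gives
`[A x, Y₀] = 0` for both generators, `Y₀` is scalar (`scalar_of_commute_gens`), and its powers are
dependent — contradiction.  This isolates the whole difficulty of the stub in the last `6L + 1`
degrees of the word filtration (the "budget wall"). [folklore] -/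
theorem stub_coreThreeSlack : ∀ C : ℕ, ∃ n₀ : ℕ, ∀ (n d L : ℕ) (A : Fin 2 → Matrix (Fin n) (Fin n) ℂ),
    n₀ ≤ n → d ≤ C * n → 1 ≤ L → L ≤ 19 →
    (∃ e : ℕ, e + 1 + 6 * L ≤ d ∧ Masquerade.wordSpan A e = ⊤) →
    Submodule.span ℂ {M : Matrix (Fin n) (Fin n) ℂ |
      ∃ w : List (Fin 2), w.length ≤ d ∧ (w.map A).prod = M} = ⊤ →
    (∃ Y₀ ∈ Masquerade.wordSpan A L, LinearIndependent ℂ (fun j : Fin 4 => Y₀ ^ (j : ℕ))) →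
    (∀ (e₁ e₂ : ℕ), 6 * L + d + e₁ + e₂ ≤ 2 * d → ∀ Y ∈ Masquerade.wordSpan A L,
      ∀ Z₁ ∈ Masquerade.wordSpan A e₁, ∀ Z₂ ∈ Masquerade.wordSpan A e₂,
      (Z₁ * Y - Y * Z₁) * (Z₂ * Y - Y * Z₂) * Y = Y * ((Z₁ * Y - Y * Z₁) * (Z₂ * Y - Y * Z₂)) ∧
      (Z₁ * Y - Y * Z₁) * Y * (Z₂ * Y - Y * Z₂) * Y =
        Y * ((Z₁ * Y - Y * Z₁) * Y * (Z₂ * Y - Y * Z₂))) → False := by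
  intro C
  refine ⟨0, fun n d L A _ _ hL1 _ ⟨e, he, htop⟩ hspan ⟨Y₀, hY₀, hind⟩ hid => ?_⟩
  -- every matrix is in `V_e`
  have hX : ∀ X : Matrix (Fin n) (Fin n) ℂ, X ∈ wordSpan A e := fun X => by
    rw [htop]; exact Submodule.mem_top
  -- the powers `1, Y₀, Y₀²` are independent
  have hind3 : LinearIndependent ℂ (fun i : Fin 3 => Y₀ ^ (i : ℕ)) := by
    have h := hind.comp (Fin.castLE (by norm_num : 3 ≤ 4)) (Fin.castLE_injective _)
    convert h using 1
    funext i
    simp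
  -- (P1) with a full first slot: `∑_{i<3} Y₀^i X Q_i = 0`
  have hcommx : ∀ x : Fin 2, A x * Y₀ - Y₀ * A x = 0 := by
    intro x
    set M := A x * Y₀ - Y₀ * A x with hM
    have hvan : ∀ X : Matrix (Fin n) (Fin n) ℂ,
        ∑ i : Fin 3, Y₀ ^ ((i : Fin 3) : ℕ) * X * (![Y₀ * M * Y₀, -(M * Y₀ + Y₀ * M), M] i) = 0 := by
      intro X
      have h := (hid e 1 (by omega) Y₀ hY₀ X (hX X) (A x) (gen_mem_wordSpan A le_rfl x)).1
      rw [Fin.sum_univ_three]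
      simp only [Fin.val_zero, pow_zero, Fin.val_one, pow_one, Fin.val_two,
        Matrix.cons_val_zero, Matrix.cons_val_one, Matrix.cons_val_two, Matrix.head_cons,
        Matrix.tail_cons]
      rw [← sub_eq_zero] at h
      rw [← h, hM]
      noncomm_ring
    have := eq_zero_of_sum_mul_mul_eq_zero hind3 hvan 2
    simpa using this
  -- hence `Y₀` is scalar and its powers are dependent
  obtain ⟨s, hs⟩ := LongMasqueradeNeg.scalar_of_commute_gens hspan (Z := Y₀)
    (fun x => by have h := sub_eq_zero.1 (hcommx x); exact h.symm)
  have hsum : ∑ j : Fin 4, (![s, -1, 0, 0] : Fin 4 → ℂ) j • Y₀ ^ (j : ℕ) = 0 := by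
    simp [Fin.sum_univ_succ, hs]
  have h1 := Fintype.linearIndependent_iff.1 hind ![s, -1, 0, 0] hsum 1
  simp at h1

end Summit.MatrixMultiplication.MatrixMultiplication.Theorems.TightWindows
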